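import Mathlib.Analysis.InnerProductSpace.Basic
import Mathlib.Analysis.Calculus.FDeriv.Prod
import Mathlib.Analysis.Calculus.FDeriv.Linear
import Mathlib.Analysis.Calculus.FDeriv.Add
import Mathlib.Analysis.Calculus.ContDiff.Basic
import HarnessLib

/-!
# From the exports of a stage to the hypotheses of the next: the `τ ⊂ σ` algebra

Topic `Literature/Topology/FourManifolds`; linear algebra serving the downward sweep of the smoothing of
PD homeomorphisms (Munkres, Ann. of Math. 72 (1960), §5; Campbell–D'Onofrio–Vítek, J. Geom. Anal.
(2026), §4).  A stage at a simplex `σ` outputs, inside its `x`-preserving zones, a map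
`(x_σ, y_σ) ↦ (x_σ, φ (x_σ, y_σ))`.  A later stage at a face `τ ⊂ ∂σ` reads this map in ITS
coordinates `E_τ × F_τ`, where `x_σ = (x_τ, ξ)` and the fibre `F_τ` splits orthogonally into the
directions `Ξ` of `σ` normal to `τ` and the fibre `F_σ` of `σ`.  The splitting is recorded by four
continuous linear maps `πΞ, πF, ιΞ, ιF` (projections and inclusions) with the obvious identities
and the Pythagoras identity `‖y‖² = ‖πΞ y‖² + ‖πF y‖²`; the normal part seen by `τ` is then

  `tauNormal πΞ πF ιΞ ιF φ (x, y) = ιΞ (πΞ y) + ιF (φ ((x, πΞ y), πF y))`   ("`N_τ = (ξ, φ)`").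

From the three **pointwise exports** of `φ` at the point — (E1) `‖D_ξφ v‖ ≤ X‖v‖`,
(E2) `c‖w‖ ≤ ‖D_yφ w‖`, (E3) `‖D_yφ·y_σ − φ‖ ≤ Y` — we derive the pointwise hypotheses of the
`τ`-stage (`TubeStageDiffeo.exists_hasFDerivAt_equiv_tubeStageMap`) at that point: the derivative
formula (`hasFDerivAt_tauNormal`), fibre injectivity (`tauNormal_fibre_injective`), the bound
`‖u‖ ≤ (X‖ξ‖ + Y)/c` for the solution of the source-defect equation
(`tauNormal_source_defect_le`), and the norm identity `‖N_τ‖² = ‖ξ‖² + ‖φ‖²`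
(`norm_tauNormal_sq`).  The tangential part seen by `τ` is `x_τ` itself, so `τ`'s flatten data
vanish identically there.  Everything is proved; the one definition is an explicit function; no
named facts.

## References

* J. R. Munkres, *Obstructions to the smoothing of piecewise-differentiable homeomorphisms*, Ann.
  of Math. (2) 72 (1960), 521–554, §5. [Munkres1960]
* D. Campbell, L. D'Onofrio, T. Vítek, *Diffeomorphic approximation of piecewise affine
  homeomorphisms*, J. Geom. Anal. 36 (2026), §4. [CampbellDonofrioVitek2026]
-/

noncomputable section

open Set Function Metric Filter
open scoped Topology ContDiff

namespace Literature.Topology.FourManifolds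

variable {Eτ : Type*} [NormedAddCommGroup Eτ] [NormedSpace ℝ Eτ]
variable {Ξ : Type*} [NormedAddCommGroup Ξ] [NormedSpace ℝ Ξ]
variable {Fσ : Type*} [NormedAddCommGroup Fσ] [NormedSpace ℝ Fσ]
variable {Fτ : Type*} [NormedAddCommGroup Fτ] [NormedSpace ℝ Fτ]

/-- **The normal part seen by the face `τ`** of an `x_σ`-preserving stage output with fibre map
`φ`, in `τ`-coordinates: `N_τ (x, y) = ιΞ (πΞ y) + ιF (φ ((x, πΞ y), πF y))`. [folklore] -/
def tauNormal (πΞ : Fτ →L[ℝ] Ξ) (πF : Fτ →L[ℝ] Fσ) (ιΞ : Ξ →L[ℝ] Fτ) (ιF : Fσ →L[ℝ] Fτ)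
    (φ : (Eτ × Ξ) × Fσ → Fσ) (p : Eτ × Fτ) : Fτ :=
  ιΞ (πΞ p.2) + ιF (φ ((p.1, πΞ p.2), πF p.2))

variable {πΞ : Fτ →L[ℝ] Ξ} {πF : Fτ →L[ℝ] Fσ} {ιΞ : Ξ →L[ℝ] Fτ} {ιF : Fσ →L[ℝ] Fτ}
  {φ : (Eτ × Ξ) × Fσ → Fσ} {p : Eτ × Fτ}

/-- The point of `σ`-coordinates under a point of `τ`-coordinates. [folklore] -/
def sigmaPoint (πΞ : Fτ →L[ℝ] Ξ) (πF : Fτ →L[ℝ] Fσ) (p : Eτ × Fτ) : (Eτ × Ξ) × Fσ :=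
  ((p.1, πΞ p.2), πF p.2)

/-- The coordinate change `(x, y) ↦ ((x, πΞ y), πF y)` as a continuous linear map. [folklore] -/
def sigmaPointCLM (πΞ : Fτ →L[ℝ] Ξ) (πF : Fτ →L[ℝ] Fσ) : (Eτ × Fτ) →L[ℝ] (Eτ × Ξ) × Fσ :=
  ((ContinuousLinearMap.fst ℝ Eτ Fτ).prod (πΞ.comp (ContinuousLinearMap.snd ℝ Eτ Fτ))).prod
    (πF.comp (ContinuousLinearMap.snd ℝ Eτ Fτ))

omit [NormedAddCommGroup Eτ] [NormedSpace ℝ Eτ] in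
/-- The `σ`-point in coordinates (definitional). [folklore] -/
@[simp]
theorem sigmaPoint_apply (p : Eτ × Fτ) : sigmaPoint πΞ πF p = ((p.1, πΞ p.2), πF p.2) := rfl

/-- The coordinate change in coordinates (definitional). [folklore] -/
@[simp]
theorem sigmaPointCLM_apply (p : Eτ × Fτ) : sigmaPointCLM πΞ πF p = ((p.1, πΞ p.2), πF p.2) := rfl

/-- **Derivative of the `τ`-normal part**: at `p`, with `L = Dφ (sigmaPoint p)`,
`D N_τ (v, w) = ιΞ (πΞ w) + ιF (L ((v, πΞ w), πF w))`. [folklore] -/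
theorem hasFDerivAt_tauNormal (hφ : DifferentiableAt ℝ φ (sigmaPoint πΞ πF p)) :
    HasFDerivAt (tauNormal πΞ πF ιΞ ιF φ)
      (ιΞ.comp (πΞ.comp (ContinuousLinearMap.snd ℝ Eτ Fτ)) +
        ιF.comp ((fderiv ℝ φ (sigmaPoint πΞ πF p)).comp (sigmaPointCLM πΞ πF))) p := by
  have h1 : HasFDerivAt (fun q : Eτ × Fτ => ιΞ (πΞ q.2)) (ιΞ.comp (πΞ.comp (ContinuousLinearMap.snd ℝ Eτ Fτ))) p :=
    (ιΞ.comp (πΞ.comp (ContinuousLinearMap.snd ℝ Eτ Fτ))).hasFDerivAt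
  have h2 : HasFDerivAt (fun q : Eτ × Fτ => φ (sigmaPoint πΞ πF q))
      ((fderiv ℝ φ (sigmaPoint πΞ πF p)).comp (sigmaPointCLM πΞ πF)) p := by
    have hlin : HasFDerivAt (fun q : Eτ × Fτ => sigmaPoint πΞ πF q) (sigmaPointCLM πΞ πF) p := by
      have := (sigmaPointCLM (Eτ := Eτ) πΞ πF).hasFDerivAt (x := p)
      exact this
    exact hφ.hasFDerivAt.comp p hlin
  exact h1.add (ιF.hasFDerivAt.comp p h2)

/-- The fibre derivative of `N_τ` applied to `(0, w)`:
`ιΞ (πΞ w) + ιF (L ((0, πΞ w), πF w))`. [folklore] -/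
theorem fderiv_tauNormal_apply_inr (hφ : DifferentiableAt ℝ φ (sigmaPoint πΞ πF p)) (w : Fτ) :
    fderiv ℝ (tauNormal πΞ πF ιΞ ιF φ) p (0, w) =
      ιΞ (πΞ w) + ιF (fderiv ℝ φ (sigmaPoint πΞ πF p) (((0 : Eτ), πΞ w), πF w)) := by
  rw [(hasFDerivAt_tauNormal hφ).fderiv]
  rfl

section Splitting

/-! The orthogonal splitting hypotheses: `πΞ ∘ ιΞ = id`, `πF ∘ ιF = id`, `πΞ ∘ ιF = 0`,
`πF ∘ ιΞ = 0`, `ιΞ ∘ πΞ + ιF ∘ πF = id`, and Pythagoras `‖y‖² = ‖πΞ y‖² + ‖πF y‖²`. -/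

variable (hΞΞ : ∀ v : Ξ, πΞ (ιΞ v) = v) (hFF : ∀ z : Fσ, πF (ιF z) = z)
  (hΞF : ∀ z : Fσ, πΞ (ιF z) = 0) (hFΞ : ∀ v : Ξ, πF (ιΞ v) = 0)
  (hsum : ∀ y : Fτ, ιΞ (πΞ y) + ιF (πF y) = y)
  (hpyth : ∀ y : Fτ, ‖y‖ ^ 2 = ‖πΞ y‖ ^ 2 + ‖πF y‖ ^ 2)

omit [NormedAddCommGroup Eτ] [NormedSpace ℝ Eτ] in
include hΞΞ hΞF in
/-- Components of `N_τ`: `πΞ (N_τ p) = πΞ p.2`. [folklore] -/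
theorem πΞ_tauNormal (p : Eτ × Fτ) : πΞ (tauNormal πΞ πF ιΞ ιF φ p) = πΞ p.2 := by
  rw [tauNormal, map_add, hΞΞ, hΞF, add_zero]

omit [NormedAddCommGroup Eτ] [NormedSpace ℝ Eτ] in
include hFF hFΞ in
/-- Components of `N_τ`: `πF (N_τ p) = φ (sigmaPoint p)`. [folklore] -/
theorem πF_tauNormal (p : Eτ × Fτ) : πF (tauNormal πΞ πF ιΞ ιF φ p) = φ (sigmaPoint πΞ πF p) := by
  rw [tauNormal, map_add, hFF, hFΞ, zero_add]
  rfl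

omit [NormedAddCommGroup Eτ] [NormedSpace ℝ Eτ] in
include hΞΞ hFF hΞF hFΞ hpyth in
/-- **Norm of the `τ`-normal part**: `‖N_τ p‖² = ‖πΞ p.2‖² + ‖φ (sigmaPoint p)‖²`. [folklore] -/
theorem norm_tauNormal_sq (p : Eτ × Fτ) :
    ‖tauNormal πΞ πF ιΞ ιF φ p‖ ^ 2 = ‖πΞ p.2‖ ^ 2 + ‖φ (sigmaPoint πΞ πF p)‖ ^ 2 := by
  rw [hpyth, πΞ_tauNormal hΞΞ hΞF, πF_tauNormal hFF hFΞ]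

omit [NormedAddCommGroup Eτ] [NormedSpace ℝ Eτ] in
include hΞΞ hFF hΞF hFΞ hpyth in
/-- `‖N_τ p‖ ≥ ‖πΞ p.2‖` and `‖N_τ p‖ ≥ ‖φ (sigmaPoint p)‖`. [folklore] -/
theorem norm_tauNormal_ge (p : Eτ × Fτ) :
    ‖πΞ p.2‖ ≤ ‖tauNormal πΞ πF ιΞ ιF φ p‖ ∧ ‖φ (sigmaPoint πΞ πF p)‖ ≤ ‖tauNormal πΞ πF ιΞ ιF φ p‖ := by
  have h := norm_tauNormal_sq hΞΞ hFF hΞF hFΞ hpyth (φ := φ) p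
  constructor
  · nlinarith [norm_nonneg (tauNormal πΞ πF ιΞ ιF φ p), norm_nonneg (πΞ p.2), sq_nonneg ‖φ (sigmaPoint πΞ πF p)‖]
  · nlinarith [norm_nonneg (tauNormal πΞ πF ιΞ ιF φ p), norm_nonneg (φ (sigmaPoint πΞ πF p)), sq_nonneg ‖πΞ p.2‖]

include hpyth in
/-- Pythagoras gives `‖πΞ y‖ ≤ ‖y‖` and `‖πF y‖ ≤ ‖y‖`. [folklore] -/
theorem norm_proj_le (y : Fτ) : ‖πΞ y‖ ≤ ‖y‖ ∧ ‖πF y‖ ≤ ‖y‖ := by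
  have h := hpyth y
  constructor
  · nlinarith [norm_nonneg y, norm_nonneg (πΞ y), sq_nonneg ‖πF y‖]
  · nlinarith [norm_nonneg y, norm_nonneg (πF y), sq_nonneg ‖πΞ y‖]

include hΞΞ hFF hΞF hFΞ hpyth in
/-- **Fibre injectivity of `N_τ`** from quantitative fibre injectivity of `φ` (export (E2) with
any `c > 0`): `D N_τ (0, w) = 0 ⟹ w = 0`. [folklore] -/
theorem tauNormal_fibre_injective (hφ : DifferentiableAt ℝ φ (sigmaPoint πΞ πF p)) {c : ℝ} (hc : 0 < c)
    (hE2 : ∀ w : Fσ, c * ‖w‖ ≤ ‖fderiv ℝ φ (sigmaPoint πΞ πF p) (((0 : Eτ), (0 : Ξ)), w)‖)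
    (w : Fτ) (h0 : fderiv ℝ (tauNormal πΞ πF ιΞ ιF φ) p (0, w) = 0) : w = 0 := by
  rw [fderiv_tauNormal_apply_inr hφ] at h0
  -- the `Ξ`-component
  have hξ : πΞ w = 0 := by
    have := congrArg πΞ h0
    rwa [map_add, hΞΞ, hΞF, add_zero, map_zero] at this
  -- the `F_σ`-component
  have hz : πF w = 0 := by
    have h1 := congrArg πF h0
    rw [map_add, hFΞ, hFF, zero_add, map_zero, hξ] at h1
    have h2 := hE2 (πF w)
    rw [h1, norm_zero] at h2
    have : ‖πF w‖ ≤ 0 := by nlinarith [norm_nonneg (πF w)]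
    exact norm_le_zero_iff.1 this
  have hn : ‖w‖ ^ 2 = 0 := by rw [hpyth, hξ, hz, norm_zero]; norm_num
  exact norm_eq_zero.1 (pow_eq_zero_iff two_ne_zero |>.1 hn)

include hΞΞ hFF hΞF hFΞ hpyth in
/-- **The source-form Euler defect of `N_τ`** from the exports of `φ`.  If
`D N_τ (0, u) = D N_τ (0, y) − N_τ (x, y)` then `πΞ u = 0` and, with (E1) `‖D_ξφ v‖ ≤ X‖v‖`,
(E2) `c‖w‖ ≤ ‖D_yφ w‖`, (E3) `‖D_yφ (πF y) − φ‖ ≤ Y`:  `c ‖u‖ ≤ X ‖πΞ y‖ + Y`. [folklore] -/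
theorem tauNormal_source_defect_le (hφ : DifferentiableAt ℝ φ (sigmaPoint πΞ πF p)) {c X Y : ℝ}
    (hE1 : ∀ v : Ξ, ‖fderiv ℝ φ (sigmaPoint πΞ πF p) (((0 : Eτ), v), (0 : Fσ))‖ ≤ X * ‖v‖)
    (hE2 : ∀ w : Fσ, c * ‖w‖ ≤ ‖fderiv ℝ φ (sigmaPoint πΞ πF p) (((0 : Eτ), (0 : Ξ)), w)‖)
    (hE3 : ‖fderiv ℝ φ (sigmaPoint πΞ πF p) (((0 : Eτ), (0 : Ξ)), πF p.2) - φ (sigmaPoint πΞ πF p)‖ ≤ Y)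
    {u : Fτ}
    (hu : fderiv ℝ (tauNormal πΞ πF ιΞ ιF φ) p (0, u) =
      fderiv ℝ (tauNormal πΞ πF ιΞ ιF φ) p (0, p.2) - tauNormal πΞ πF ιΞ ιF φ p) :
    πΞ u = 0 ∧ c * ‖u‖ ≤ X * ‖πΞ p.2‖ + Y := by
  set L := fderiv ℝ φ (sigmaPoint πΞ πF p) with hL
  rw [fderiv_tauNormal_apply_inr hφ, fderiv_tauNormal_apply_inr hφ] at hu
  -- `Ξ`-components: `πΞ u = πΞ y − πΞ y = 0`
  have hξ : πΞ u = 0 := by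
    have h := congrArg πΞ hu
    rw [map_add, hΞΞ, hΞF, add_zero, map_sub, map_add, hΞΞ, hΞF, add_zero,
      πΞ_tauNormal hΞΞ hΞF, sub_self] at h
    exact h
  refine ⟨hξ, ?_⟩
  -- `F_σ`-components
  have hz : L (((0 : Eτ), (0 : Ξ)), πF u) =
      L (((0 : Eτ), πΞ p.2), (0 : Fσ)) + (L (((0 : Eτ), (0 : Ξ)), πF p.2) - φ (sigmaPoint πΞ πF p)) := by
    have h := congrArg πF hu
    rw [map_add, hFΞ, hFF, zero_add, map_sub, map_add, hFΞ, hFF, zero_add,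
      πF_tauNormal hFF hFΞ, hξ] at h
    rw [h, ← add_sub_assoc, ← map_add]
    congr 2
    ext <;> simp
  -- norms
  have h1 := hE2 (πF u)
  rw [hz] at h1
  have h2 : ‖L (((0 : Eτ), πΞ p.2), (0 : Fσ)) + (L (((0 : Eτ), (0 : Ξ)), πF p.2) - φ (sigmaPoint πΞ πF p))‖
      ≤ X * ‖πΞ p.2‖ + Y := (norm_add_le _ _).trans (add_le_add (hE1 _) hE3)
  -- `‖u‖ = ‖πF u‖` since `πΞ u = 0`
  have hnorm : ‖u‖ = ‖πF u‖ := by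
    have h := hpyth u
    rw [hξ, norm_zero] at h
    have h' : ‖u‖ ^ 2 = ‖πF u‖ ^ 2 := by rw [h]; ring
    exact (sq_eq_sq₀ (norm_nonneg _) (norm_nonneg _)).1 h'
  rw [hnorm]
  exact h1.trans h2

end Splitting

end Literature.Topology.FourManifolds
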